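import Literature.Geometry.Kaehler.ChartWindowBlowUp
import Literature.Geometry.Kaehler.HolomorphicChainBlowUpContinuous

/-!
# The sheet number of the blow-ups over a chart window does not depend on the radius

Continuing `ChartWindowBlowUp.lean`: for a holomorphic `p`-chain `T` (`p = q + 1`), a base point
`b` with `𝐁(b, r₀) ⊆ Ω`, and a chart window `W` (closed tube in `𝐁(0, ρ₀)`, `ρ₀ < 1`) such that
the pulled-back carriers `A_r⁻¹(reg|T|)` stay vertically `τ/16`-close to the graph in the tube for
all `0 < r < r₀`, the integer `c(r)` with `q_#(D_r ⌞ innerCore) ⌞ {‖k‖ < a₃} = c(r) · [disc]`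
(`HolomorphicChain.exists_int_restrictSet_projPiece_eq`) is **the same for all `0 < r < r₀`**
(`HolomorphicChain.exists_sheetNumber`).

Proof: testing against the probe form `ψ₀ = β · om₀` (`β` a bump at `m` supported in the slab,
`om₀(e) = 1`) gives `c(r) · ∫_disc β = Q_r(ψ₀) = D_r(ψ₁)` for a fixed test form `ψ₁` on the unit
ball; `r ↦ D_r(ψ₁)` is continuous (`HolomorphicChain.continuousOn_blowUp_apply`), so the
integer-valued `c` is constant on the interval (intermediate value theorem).

Definitions with bodies (the probe bump/form/integral) + theorems; no named facts.

## References

* H. Federer, *Geometric Measure Theory*, Springer 1969, 4.1.31, 4.3.16–4.3.18 [Federer1969].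
* J. R. King, *The currents defined by analytic varieties*, Acta Math. 127 (1971), §5.
-/

noncomputable section

open scoped Manifold Topology ENNReal NNReal InnerProductSpace ContDiff Distributions
open Set Filter MeasureTheory Metric Function Module TopologicalSpace Real

namespace Literature.Geometry.Kaehler

open Literature.Geometry.GeometricMeasureTheory

-- Nested operator-norm instances on (duals of) `V [⋀^Fin n]→L[ℝ] ℝ`.
set_option maxSynthPendingDepth 2

universe u

variable {V : Type u} [NormedAddCommGroup V] [InnerProductSpace ℂ V] [FiniteDimensional ℂ V]

/-! ### The probe form of a window -/

namespace ChartWindow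

variable (W : ChartWindow V)

/-- The probe bump `β(x) = σ(((a₃/2)² − ‖x − m‖²)/((a₃/2)² − (a₃/4)²))`: `1` on `𝐁(m, a₃/4)`,
`0` off `B(m, a₃/2)`. [folklore] -/
def probeBump (x : V) : ℝ :=
  smoothTransition (((W.a₃ / 2) ^ 2 - ‖x - W.m‖ ^ 2) / ((W.a₃ / 2) ^ 2 - (W.a₃ / 4) ^ 2))

/-- `0 ≤ β`. [folklore] -/
theorem probeBump_nonneg (x : V) : 0 ≤ W.probeBump x := smoothTransition.nonneg _

/-- `β ≤ 1`. [folklore] -/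
theorem probeBump_le_one (x : V) : W.probeBump x ≤ 1 := smoothTransition.le_one _

/-- `β = 1` on `𝐁(m, a₃/4)`. [folklore] -/
theorem probeBump_eq_one {x : V} (hx : ‖x - W.m‖ ≤ W.a₃ / 4) : W.probeBump x = 1 := by
  have ha := W.a₃_pos
  refine smoothTransition.one_of_one_le ?_
  rw [le_div_iff₀ (by nlinarith), one_mul]
  nlinarith [norm_nonneg (x - W.m)]

/-- `β = 0` off `B(m, a₃/2)`. [folklore] -/
theorem probeBump_eq_zero {x : V} (hx : W.a₃ / 2 ≤ ‖x - W.m‖) : W.probeBump x = 0 := by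
  have ha := W.a₃_pos
  refine smoothTransition.zero_of_nonpos (div_nonpos_of_nonpos_of_nonneg ?_ ?_)
  · nlinarith [norm_nonneg (x - W.m)]
  · nlinarith

/-- `support β ⊆ B(m, a₃/2)`. [folklore] -/
theorem support_probeBump_subset : support W.probeBump ⊆ ball W.m (W.a₃ / 2) := by
  intro x hx
  rw [mem_ball, dist_eq_norm]
  by_contra h
  exact hx (W.probeBump_eq_zero (not_lt.1 h))

/-- `β` is smooth. [folklore] -/
theorem contDiff_probeBump : ContDiff ℝ ∞ W.probeBump := by
  have h1 : ContDiff ℝ ∞ fun x : V => ‖x - W.m‖ ^ 2 := (contDiff_id.sub contDiff_const).norm_sq (𝕜 := ℂ)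
  exact smoothTransition.contDiff.comp ((contDiff_const.sub h1).div_const _)

/-- `β` has compact support. [folklore] -/
theorem hasCompactSupport_probeBump : HasCompactSupport W.probeBump := by
  haveI : FiniteDimensional ℝ V := FiniteDimensional.complexToReal V
  haveI : ProperSpace V := FiniteDimensional.proper ℝ V
  refine HasCompactSupport.of_support_subset_isCompact (isCompact_closedBall W.m (W.a₃ / 2)) ?_
  exact W.support_probeBump_subset.trans ball_subset_closedBall

/-- **The probe form `ψ₀ = β · η`** of the window. [folklore] -/
def probeForm {m : ℕ} (η : Covector V m) : TestForm (⊤ : Opens V) m :=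
  ⟨fun x => W.probeBump x • η, W.contDiff_probeBump.smul contDiff_const,
    W.hasCompactSupport_probeBump.smul_right, subset_univ _⟩

/-- Unfolding the probe form. [folklore] -/
@[simp] theorem probeForm_apply {m : ℕ} (η : Covector V m) (x : V) : W.probeForm η x = W.probeBump x • η := rfl

/-- `support ψ₀ ⊆ slab`. [folklore] -/
theorem support_probeForm_subset {m : ℕ} (η : Covector V m) : support ⇑(W.probeForm η) ⊆ W.slab := by
  intro x hx
  have hx' : x ∈ support W.probeBump := by
    intro h; exact hx (by simp [h])
  have := W.support_probeBump_subset hx'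
  rw [mem_ball, dist_eq_norm] at this
  show ‖W.kf x‖ < W.a₃
  calc ‖W.kf x‖ ≤ ‖x - W.m‖ := W.K.norm_orthogonalProjectionOnto_apply_le _
    _ < W.a₃ := by linarith [W.a₃_pos]

/-- `tsupport ψ₀ ⊆ slab`. [folklore] -/
theorem tsupport_probeForm_subset {m : ℕ} (η : Covector V m) : tsupport ⇑(W.probeForm η) ⊆ W.slab := by
  haveI : FiniteDimensional ℝ V := FiniteDimensional.complexToReal V
  intro x hx
  have h1 : tsupport ⇑(W.probeForm η) ⊆ closedBall W.m (W.a₃ / 2) := by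
    refine closure_minimal ?_ isClosed_closedBall
    intro y hy
    have hy' : y ∈ support W.probeBump := by intro h; exact hy (by simp [h])
    exact ball_subset_closedBall (W.support_probeBump_subset hy')
  have := h1 hx
  rw [mem_closedBall, dist_eq_norm] at this
  show ‖W.kf x‖ < W.a₃
  calc ‖W.kf x‖ ≤ ‖x - W.m‖ := W.K.norm_orthogonalProjectionOnto_apply_le _
    _ < W.a₃ := by linarith [W.a₃_pos]

section Measure

variable [MeasurableSpace V] [BorelSpace V]

/-- The probe integral `I = ∫_{disc} β d𝓗ⁿ`. [folklore] -/
def probeIntegral (n : ℕ) : ℝ :=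
  letI : InnerProductSpace ℝ V := InnerProductSpace.complexToReal
  ∫ x in W.slab ∩ {x | x - W.m ∈ W.K}, W.probeBump x ∂(μHE[n] : Measure V)

omit [MeasurableSpace V] [BorelSpace V] in
/-- The small disc `m + 𝐁_K(0, a₃/4)` lies in `slab ∩ (m + K)` and `β = 1` on it. [folklore] -/
theorem image_closedBall_subset :
    (fun k : W.K => W.m + (k : V)) '' closedBall (0 : W.K) (W.a₃ / 4) ⊆ W.slab ∩ {x | x - W.m ∈ W.K} := by
  rintro _ ⟨k, hk, rfl⟩
  rw [mem_closedBall, dist_zero_right] at hk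
  refine ⟨?_, by simp⟩
  show ‖W.kf (W.m + (k : V))‖ < W.a₃
  have : W.kf (W.m + (k : V)) = k := by
    simp only [ChartWindow.kf, add_sub_cancel_left]
    exact W.K.orthogonalProjectionOnto_mem_subspace_eq_self k
  rw [this]
  linarith [W.a₃_pos]

/-- **The probe integral is positive** (`n = 2p = dim_ℝ K`). [folklore] -/
theorem probeIntegral_pos {q : ℕ} (hKp : finrank ℂ W.K = q + 1) : 0 < W.probeIntegral (2 * (q + 1)) := by
  letI : InnerProductSpace ℝ V := InnerProductSpace.complexToReal
  letI : InnerProductSpace ℝ W.K := InnerProductSpace.complexToReal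
  letI : MeasurableSpace W.K := borel W.K
  haveI : BorelSpace W.K := ⟨rfl⟩
  haveI : FiniteDimensional ℝ W.K := FiniteDimensional.complexToReal W.K
  set D : Set V := W.slab ∩ {x | x - W.m ∈ W.K} with hD
  set S : Set V := (fun k : W.K => W.m + (k : V)) '' closedBall (0 : W.K) (W.a₃ / 4) with hS
  have hiso : Isometry (fun k : W.K => W.m + (k : V)) :=
    Isometry.of_dist_eq fun x y => by
      rw [dist_eq_norm, dist_eq_norm, add_sub_add_left_eq_sub, ← Submodule.coe_sub, Submodule.coe_norm]
  have hdim : finrank ℝ W.K = 2 * (q + 1) := by rw [finrank_real_of_complex, hKp]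
  have hSm : (μHE[2 * (q + 1)] : Measure V) S = volume (closedBall (0 : W.K) (W.a₃ / 4)) := by
    rw [hS, hiso.euclideanHausdorffMeasure_image, ← hdim, InnerProductSpace.euclideanHausdorffMeasure_eq_volume]
  have hSpos : 0 < (μHE[2 * (q + 1)] : Measure V) S := by
    rw [hSm]; exact measure_closedBall_pos volume _ (by linarith [W.a₃_pos])
  have hStop : (μHE[2 * (q + 1)] : Measure V) S < ⊤ := by
    rw [hSm]; exact measure_closedBall_lt_top
  have hDfin : (μHE[2 * (q + 1)] : Measure V) D < ⊤ := W.measure_slab_inter_plane_lt_top hKp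
  have hSD : S ⊆ D := W.image_closedBall_subset
  have hint : IntegrableOn W.probeBump D (μHE[2 * (q + 1)] : Measure V) := by
    refine Measure.integrableOn_of_bounded (M := 1) hDfin.ne W.contDiff_probeBump.continuous.aestronglyMeasurable ?_
    exact Eventually.of_forall fun x => by
      rw [Real.norm_eq_abs, abs_of_nonneg (W.probeBump_nonneg x)]; exact W.probeBump_le_one x
  have h1 : ∫ x in S, W.probeBump x ∂(μHE[2 * (q + 1)] : Measure V) =
      ((μHE[2 * (q + 1)] : Measure V) S).toReal := by
    have hSm' : MeasurableSet S :=
      (hiso.isClosedEmbedding.isClosedMap _ isClosed_closedBall).measurableSet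
    rw [setIntegral_congr_fun hSm' (fun x hx => ?_), setIntegral_const, smul_eq_mul, mul_one]
    · rfl
    · obtain ⟨k, hk, rfl⟩ := hx
      rw [mem_closedBall, dist_zero_right] at hk
      refine W.probeBump_eq_one ?_
      rwa [add_sub_cancel_left, Submodule.norm_coe]
  calc (0 : ℝ) < ((μHE[2 * (q + 1)] : Measure V) S).toReal := ENNReal.toReal_pos hSpos.ne' hStop.ne
    _ = ∫ x in S, W.probeBump x ∂(μHE[2 * (q + 1)] : Measure V) := h1.symm
    _ ≤ ∫ x in D, W.probeBump x ∂(μHE[2 * (q + 1)] : Measure V) :=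
        setIntegral_mono_set hint (Eventually.of_forall fun x => W.probeBump_nonneg x)
          (Eventually.of_forall hSD)

/-- **The disc current evaluated on the probe form**: `[disc, c, e](β η) = c · η(e) · I`. [folklore] -/
theorem currentOfIntegration_disc_probeForm {q : ℕ} (hKp : finrank ℂ W.K = q + 1) (c : ℤ)
    (e' : Fin (2 * (q + 1)) → V) (η : Covector V (2 * (q + 1))) :
    letI : InnerProductSpace ℝ V := InnerProductSpace.complexToReal
    (currentOfIntegration (W.slab ∩ {x | x - W.m ∈ W.K}) (fun _ => c) (fun _ => e') :
      Current (⊤ : Opens V) (2 * (q + 1))) (W.probeForm η) = c * η e' * W.probeIntegral (2 * (q + 1)) := by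
  letI : InnerProductSpace ℝ V := InnerProductSpace.complexToReal
  have hDfin : (μHE[2 * (q + 1)] : Measure V) (W.slab ∩ {x | x - W.m ∈ W.K}) < ⊤ :=
    W.measure_slab_inter_plane_lt_top hKp
  have hli : LocallyIntegrableOn (fun x : V => ((c : ℤ) : ℝ) • frameVector e') ((⊤ : Opens V) : Set V)
      ((μHE[2 * (q + 1)] : Measure V).restrict (W.slab ∩ {x | x - W.m ∈ W.K})) := by
    haveI : IsFiniteMeasure ((μHE[2 * (q + 1)] : Measure V).restrict (W.slab ∩ {x | x - W.m ∈ W.K})) :=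
      ⟨by rwa [Measure.restrict_apply_univ]⟩
    exact (integrable_const _).locallyIntegrable.locallyIntegrableOn _
  rw [currentOfIntegration_apply hli]
  simp only [probeForm_apply, ContinuousAlternatingMap.smul_apply, smul_eq_mul]
  rw [probeIntegral, ← integral_const_mul]
  congr 1
  funext x
  ring

end Measure

end ChartWindow

/-! ### The sheet number is independent of the radius -/

namespace HolomorphicChain

variable [MeasurableSpace V] [BorelSpace V] {Ω : Opens V} {q : ℕ}

omit [FiniteDimensional ℂ V] [MeasurableSpace V] [BorelSpace V] in
/-- **A covector dual to an orthonormal frame**: `∃ η, η(v) = 1`. [folklore] -/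
theorem exists_covector_apply_eq_one {m : ℕ} {v : Fin m → V}
    (hv : letI : InnerProductSpace ℝ V := InnerProductSpace.complexToReal; Orthonormal ℝ v) :
    ∃ η : Covector V m, η v = 1 := by
  letI : InnerProductSpace ℝ V := InnerProductSpace.complexToReal
  have hne : frameVector v ≠ 0 := by
    intro h
    have := norm_frameVector_eq_one hv
    rw [h, norm_zero] at this
    exact zero_ne_one this
  obtain ⟨η, hω⟩ := DFunLike.ne_iff.1 hne
  have hω' : η v ≠ 0 := by simpa using hω
  refine ⟨(η v)⁻¹ • η, ?_⟩
  simp [hω']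

variable (T : HolomorphicChain 𝓘(ℂ, V) Ω (q + 1)) {b : V} {r₀ : ℝ} (hr₀ : 0 < r₀)
  (hΩ : closedBall b r₀ ⊆ (Ω : Set V)) (W : ChartWindow V) (hKp : finrank ℂ W.K = q + 1) {ρ₀ : ℝ}
  (hρ₀ : ρ₀ < 1) (hW : W.closedTube ⊆ closedBall (0 : V) ρ₀)
  (htube : ∀ r ∈ Ioo 0 r₀, T.blowUpSet b r ∩ W.closedTube ⊆ {x | ‖W.wf x‖ < W.τ / 16})

include hΩ hKp hρ₀ hW in
/-- **The sheet identity**: for `0 < r < r₀`, the sheet number `c(r)` of the window satisfies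
`c(r) · I = D_r(ψ₁)` for the fixed unit-ball test form `ψ₁ = χ · q^*(β om₀)` (`om₀(e) = 1`).
[cite: Federer1969, 4.1.31, 4.3.16] -/
theorem sheet_identity {M : ℝ} (hM : ∀ k ∈ ball (0 : W.K) W.ρ, ‖fderiv ℂ W.Ψ k‖ ≤ M)
    (bK : OrthonormalBasis (Fin (q + 1)) ℂ W.K) :
    letI : InnerProductSpace ℝ V := InnerProductSpace.complexToReal
    letI : InnerProductSpace ℝ W.K := InnerProductSpace.complexToReal
    ∀ e : OrthonormalBasis (Fin (2 * (q + 1))) ℝ W.K, ⇑e = complexFrame ⇑bK →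
    ∀ om₀ : Covector V (2 * (q + 1)), om₀ (fun i => ((e i : W.K) : V)) = 1 →
    ∃ ψ₁ : TestForm (unitBall V) (2 * (q + 1)), ∀ r ∈ Ioo 0 r₀,
      ∀ (hQr : (T.projPiece b r W hM).IsRepresentable) (c : ℤ),
        hQr.restrictSet W.slab W.isOpen_slab.measurableSet =
          currentOfIntegration (W.slab ∩ {x | x - W.m ∈ W.K}) (fun _ => c)
            (fun _ => fun i => ((e i : W.K) : V)) →
        (c : ℝ) * W.probeIntegral (2 * (q + 1)) = T.blowUp b r ψ₁ := by
  letI : InnerProductSpace ℝ V := InnerProductSpace.complexToReal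
  letI : InnerProductSpace ℝ W.K := InnerProductSpace.complexToReal
  intro e he om₀ hom₀
  -- the fixed test form on the unit ball
  set ψ₀ : TestForm (⊤ : Opens V) (2 * (q + 1)) := W.probeForm om₀ with hψ₀
  set ψp : TestForm (⊤ : Opens V) (2 * (q + 1)) := TestForm.pullback (W.cutoff hM) W.contDiff_proj ψ₀
    with hψp
  have hψp_supp : tsupport ⇑ψp ⊆ W.innerCore :=
    W.tsupport_pullback_cutoff_subset_innerCore hM ψ₀ (W.tsupport_probeForm_subset om₀)
  have hIC : W.innerCore ⊆ closedBall (0 : V) ρ₀ := innerCore_subset_closedBall W hW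
  have hψp1 : tsupport ⇑ψp ⊆ ((unitBall V : Opens V) : Set V) :=
    (hψp_supp.trans hIC).trans (closedBall_subset_ball hρ₀)
  set ψ₁ : TestForm (unitBall V) (2 * (q + 1)) := ⟨ψp, ψp.contDiff, ψp.hasCompactSupport, hψp1⟩ with hψ₁
  have hmono : (TestFunction.monoCLM ℝ ψ₁ : TestForm (⊤ : Opens V) (2 * (q + 1))) = ψp := by
    ext x v
    rw [TestForm.monoCLM_apply_of_le (show unitBall V ≤ (⊤ : Opens V) from le_top)]
    rfl
  refine ⟨ψ₁, fun r hr hQr c hc => ?_⟩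
  have hball : ball b r ⊆ (Ω : Set V) := (ball_subset_closedBall.trans (closedBall_subset_closedBall hr.2.le)).trans hΩ
  -- `Q_r(ψ₀) = c · I`
  have h1 : T.projPiece b r W hM ψ₀ = c * W.probeIntegral (2 * (q + 1)) := by
    rw [← hQr.restrictSet_apply_of_support_subset W.isOpen_slab.measurableSet (W.support_probeForm_subset om₀),
      hc, W.currentOfIntegration_disc_probeForm hKp c _ om₀, hom₀, mul_one]
  -- `Q_r(ψ₀) = D_r(ψ₁)`
  have h2 : T.projPiece b r W hM ψ₀ = T.blowUp b r ψ₁ := by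
    rw [projPiece, Current.pushforward_apply, corePiece,
      T.blowUp_apply_eq_blowUpPiece hr.1 hball W.isOpen_innerCore.measurableSet hρ₀ hIC ψ₁
        (by simpa [hψ₁] using hψp_supp), hmono]
  rw [← h1, h2]

include hr₀ hΩ hKp hρ₀ hW htube in
/-- **The sheet number of the blow-ups over the window is independent of the radius**: there is
one integer `c` with `q_#(D_r ⌞ innerCore) ⌞ {‖k‖ < a₃} = c · [m + ball_K(0, a₃)]` for all
`0 < r < r₀`. [cite: Federer1969, 4.1.31, 4.3.16–4.3.18; King 1971, §5] -/
theorem exists_sheetNumber {M : ℝ} (hM : ∀ k ∈ ball (0 : W.K) W.ρ, ‖fderiv ℂ W.Ψ k‖ ≤ M)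
    (bK : OrthonormalBasis (Fin (q + 1)) ℂ W.K) :
    letI : InnerProductSpace ℝ V := InnerProductSpace.complexToReal
    letI : InnerProductSpace ℝ W.K := InnerProductSpace.complexToReal
    ∀ e : OrthonormalBasis (Fin (2 * (q + 1))) ℝ W.K, ⇑e = complexFrame ⇑bK →
    ∃ c : ℤ, ∀ r ∈ Ioo 0 r₀, ∃ hQr : (T.projPiece b r W hM).IsRepresentable,
      hQr.restrictSet W.slab W.isOpen_slab.measurableSet =
        currentOfIntegration (W.slab ∩ {x | x - W.m ∈ W.K}) (fun _ => c)
          (fun _ => fun i => ((e i : W.K) : V)) := by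
  letI : InnerProductSpace ℝ V := InnerProductSpace.complexToReal
  letI : InnerProductSpace ℝ W.K := InnerProductSpace.complexToReal
  intro e he
  -- the sheet numbers `c(r)`
  have hex : ∀ r ∈ Ioo 0 r₀, ∃ (hQr : (T.projPiece b r W hM).IsRepresentable) (c : ℤ),
      hQr.restrictSet W.slab W.isOpen_slab.measurableSet =
        currentOfIntegration (W.slab ∩ {x | x - W.m ∈ W.K}) (fun _ => c)
          (fun _ => fun i => ((e i : W.K) : V)) := fun r hr =>
    T.exists_int_restrictSet_projPiece_eq hr.1
      ((ball_subset_closedBall.trans (closedBall_subset_closedBall hr.2.le)).trans hΩ) W hKp hρ₀ hW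
      (htube r hr) hM bK e he
  choose hQr cf hcf using hex
  -- a dual covector and the sheet identity
  have he' : Orthonormal ℝ fun i => ((e i : W.K) : V) := by
    have := e.orthonormal
    rw [orthonormal_iff_ite] at this ⊢
    intro i j
    rw [← this i j]
    rfl
  obtain ⟨om₀, hom₀⟩ := exists_covector_apply_eq_one he'
  obtain ⟨ψ₁, hψ₁⟩ := T.sheet_identity hΩ W hKp hρ₀ hW hM bK e he om₀ hom₀
  have hI := W.probeIntegral_pos hKp
  set g : ℝ → ℝ := fun r => T.blowUp b r ψ₁ / W.probeIntegral (2 * (q + 1)) with hg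
  have hgc : ContinuousOn g (Ioo 0 r₀) := (T.continuousOn_blowUp_apply hΩ ψ₁).div_const _
  have hgv : ∀ r (hr : r ∈ Ioo 0 r₀), g r = cf r hr := fun r hr => by
    have := hψ₁ r hr (hQr r hr) (cf r hr) (hcf r hr)
    rw [hg]
    field_simp
    linarith
  -- `c(r)` is constant (intermediate value theorem)
  have hconst : ∀ r (hr : r ∈ Ioo 0 r₀) r' (hr' : r' ∈ Ioo 0 r₀), cf r hr = cf r' hr' := by
    -- first `cf r ≤ cf r'` is impossible to be strict, by symmetry it suffices to rule out `<`
    suffices hlt : ∀ r (hr : r ∈ Ioo 0 r₀) r' (hr' : r' ∈ Ioo 0 r₀), ¬ cf r hr < cf r' hr' by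
      intro r hr r' hr'
      rcases lt_trichotomy (cf r hr) (cf r' hr') with h | h | h
      · exact absurd h (hlt r hr r' hr')
      · exact h
      · exact absurd h (hlt r' hr' r hr)
    intro r hr r' hr' hlt
    have hv : ((cf r hr : ℝ) + 1 / 2) ∈ Icc (g r) (g r') := by
      rw [hgv r hr, hgv r' hr']
      constructor
      · linarith
      · have : (cf r hr : ℝ) + 1 ≤ cf r' hr' := by exact_mod_cast hlt
        linarith
    obtain ⟨s, hs, hgs⟩ := isPreconnected_Ioo.intermediate_value hr hr' hgc hv
    rw [hgv s hs] at hgs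
    have h2 : (2 * cf s hs : ℤ) = 2 * cf r hr + 1 := by
      have : (2 * cf s hs : ℝ) = 2 * cf r hr + 1 := by rw [hgs]; ring
      exact_mod_cast this
    omega
  obtain ⟨r₁, hr₁⟩ : (Ioo 0 r₀).Nonempty := nonempty_Ioo.2 hr₀
  refine ⟨cf r₁ hr₁, fun r hr => ⟨hQr r hr, ?_⟩⟩
  rw [hcf r hr, hconst r hr r₁ hr₁]

end HolomorphicChain

end Literature.Geometry.Kaehler
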